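import Summits.CriticalPhenomena.PercolationContinuityZ3.Theorems.Transplant.SkelPhiFaceRouteHrouteX6FVC
import Summits.CriticalPhenomena.PercolationContinuityZ3.Theorems.Transplant.SkelPhiFaceRouteNumbersX7FCQ
import HarnessLib

/-!
# WAVE-Q binder row «SkelPhiFaceRouteHrouteX6FVC» ↦ «SkelPhiFaceRouteHrouteX6FVCQ» (quasi-step rung (N3-b); captain gen-1 g4, WAVE-Q-BINDER-rows v0.7/v0.8, row Q56, FLOOR row; family stmt-g33 = «SkelPhiCorridor*» / «SkelPhiFace*»):
# **THE ROUTE AT EVERY CENTRE OF AN x-FACE STEP FROM THE PER-CENTRE NUMBERS, UNDER EXACT-FOOTPRINT QUASI-STEPS** — `Skelφ.hroute_of_faceRunNums_x6FVCQ`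

builds on p205010 (kernel theorem, internal audit signed; external expert review pending) — nothing in this file uses p205010; nothing here is a claim about any open node (the
quasi-step node's statement, name and wording are a lead's).  Lane `prim-bschramm`, seat `prim-bschramm-stmt` gen 33 (port pen).  Helper file (`--supports stmt-CriticalPhenomena-4575 --as helper`);
def-free.  PORT RULES (captain #6109/#6122 hunk classes + R-1 = L-hp8-1 (b)): twin of the one `hstep`-threading declaration of the tree module «SkelPhiFaceRouteHrouteX6FVC» (sha256 c431b63cf137f60c…, imported: its
Steps-free geometry lemmas are USED, not re-declared), statement and proof BYTE-IDENTICAL except: (i) `(hstep : Steps G φ) ↦ {Mq : ℕ} (hqφ : Skelφ.QStepsN G φ Mq)` (named `Mq`: the window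
half-width is already called `M`), with the frame-cost floors `hPNb : 1 ≤ Pb.N ↦ Mq ≤ Pb.N`, `hPNr : kq + 3 ≤ Pr.N ↦ Mq·(kq+3) ≤ Pr.N`; (ii) `faceRoute_of_numbers7_xFC ↦ …FCQ` («SkelPhiFaceRouteNumbersX7FCQ» Q51,
this seat); (iv) FLOOR tokens (p5-g28's pull list): `hπ1 : ‖B.core1Lo‖₁ ≤ r ↦ Mq·‖B.core1Lo‖₁ ≤ r`; kit floors `KCmaxb ↦ Pb.N·KCmaxb`, `KCmaxr ↦ Pr.N·KCmaxr` in `hDw·`, `hT'·`, `hr₀·`, `hrs·`, `hE·`,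
`hreach·`, `KCmax· + 1 ↦ (KCmax·+1)·(P·.N+2)` in `hcS·`; and — LOCATED DESIGN ITEM L-stmt-1, OPTION (C) (bus 2026-08-27T09:24:31Z; refuter read p5-g28 09:25:46Z: sound, cheapest,
floor rule PASS) — TWO EXTRA HYPOTHESIS FAMILIES `hπ2M`, `hπ3M` next to the per-centre numbers `nums`: the run-LENGTH summands of the nonempty-target floors scale with the quasi-step
cost (`RcL + Mq·((Nr+1)·shearUnit) ≤ r`, `RcT + Mq·col(k) ≤ r` — x-face: along run x, tangential run y′), which the `Mq`-free FIELDS `hπ2/hπ3` of the Steps-free structure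
`FaceRunNumsX4` cannot carry; they are phrased over the numbers' own `RcL/RcT/Nr/N₃` (at the providers Q16/Q24 these are the named choice functions, so the
T/slot layer discharges them like every other ×M floor — K-2); the fields `𝓝.hπ2/𝓝.hπ3` are simply not read.  No landed file is edited or re-issued.
Regression: `Mq = 1`, `P·.N`-tokens at `qStepsN_of_steps`, `hπ2M/hπ3M := 𝓝.hπ2/𝓝.hπ3` (after `one_mul`) give the original.  Docstrings and citations are the original's.
-/

noncomputable section

open MeasureTheory ProbabilityTheory
open scoped ENNReal Classical

namespace Summit.CriticalPhenomena.PercolationContinuityZ3.Theorems.Transplant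

open Literature.Probability.Percolation Literature.Probability.LatticeModels SimpleGraph GadgetSystem Contour KNCells
open Literature.Probability.Percolation.KozmaNitzan.Cells (oth sgOf stepVec_apply_fst)
open KNLevels ChainPlanar ChainPara
open Literature.Barriers.CriticalPhenomena (graphBall mem_graphBall_self graphBall_mono)
open BoxProdZ2 (ConcRadiiG)
open Skel (winGraph routeW excess)
open SkelI (tanOff)
open TwoAxis.Para (modulus detD)

variable {V : Type} [DecidableEq V] {G : SimpleGraph V} [G.LocallyFinite]

namespace Skelφ

variable {φ : V → Site 2}

/-! ## The route at every centre of an x-face step -/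

/-- (WAVE-Q twin of `hroute_of_faceRunNums_x6FVC` under `QStepsN G φ Mq`, L-stmt-1 option (C): two extra floor families `hπ2M/hπ3M` beside the numbers; `hπ1` ×`Mq`; kit floors ×`Pb.N`/`Pr.N` per the header.) **THE ROUTE AT EVERY CENTRE OF AN x-FACE STEP FROM THE PER-CENTRE NUMBERS** (the `hroute` input of `hkits_faceStepWNbG`; see the
module docstring). [cite: KozmaNitzan2024, §4 Lemma 10 (pp. 17–21), Lemma 11 (pp. 22–23), Lemma 12 (pp. 23–25)] -/
theorem hroute_of_faceRunNums_x6FVCQ [Countable V] (hlipφ : Lip G φ) {Mq : ℕ} (hqφ : QStepsN G φ Mq)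
    {Δg : ℕ} (hΔg : ∀ v, G.degree v ≤ Δg)
    -- the face frame and the face step of the twin schemeO
    (pr : FinePrm) (w₀ : V) (du : MDir) (b : Fin 2) (hc₀ : 0 < pr.c₀) (hc₁ : 0 < pr.c₁) (hD : 0 < pr.D) (hL0 : pr.c₀ * pr.L 0 ≤ pr.D)
    (hL1 : pr.c₁ * pr.L 1 ≤ pr.D) (hA0 : 0 < pr.A) (hnz : pr.lvGen du.1 b ≠ 0) {nL : ℕ} (hnL : 1 ≤ nL) (hvL : |pr.vα| ≤ nL)
    (hmf : 0 ≤ modulus nL pr.h pr.vα pr.vβ)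
    (P : PCells2V) (Λ : ConcRadiiG) (b₀ : Fin 2 → ℕ) (a' : ℕ) (x : Site 2) (j : ℕ) (pc : ℤ) (aw Rlev N M L' : ℕ) (Sfin : Finset V)
    {k₀ : ℤ} (hk₀ : pr.rdN du.1 b ≤ pr.rdK du.1 b * k₀) (hjK : j + 1 ≤ P.K) (hbpar : (b₀ du.1 : ℤ) + 2 ≤ 5 * P.r du.1)
    (hbperp : (b₀ (oth du.1) : ℤ) + k₀ + 3 ≤ 5 * P.r (oth du.1)) {E r : ℕ} (hrE : r ≤ Λ.rE a' x du)
    {Wt : Sym2 V → unitInterval} {q : unitInterval} (hWG : ∀ e, e ∉ G.edgeSet → Wt e = 0)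
    (hWD : IsSubbox (winGraph G w₀ (Λ.rE a' x du)) Wt q
      (stepRg G (pr.frame φ w₀ du.1 b) (faceStepWNbV G pr φ P w₀ Λ b₀ b a' x du j pc aw Rlev N M L' Sfin)))
    {σ : ℤ} (hσ : σ = 1 ∨ σ = -1)
    (B : BridgePrm) (hB : BridgeOK B) {kq : ℕ} (hκL : pr.h.natAbs ≤ kq * nL) (ℓ' R's qB Rl R'₃ qB₃ : ℕ)
    (hlay : (nL + pr.h.natAbs : ℕ) ≤ (nL : ℤ) * ℓ' + 1)
    (Rlev₁ N₁ j₀₁ j₁₁ Rlev₂ N₂ j₀₂ j₁₂ Rlev₃ N₃' j₀₃ j₁₃ : ℕ) (hRl₁ : Rlev₁ + 1 ≤ B.R') (hRl₂ : Rlev₂ + 1 ≤ R's) (hRl₃ : Rlev₃ + 1 ≤ R'₃)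
    (hj₁ : j₁₁ ≤ Rlev₁) (hj₂ : j₁₂ ≤ Rlev₂) (hj₃ : j₁₃ ≤ Rlev₃)
    (hB0 : Finset.Icc (pt nL (σ * pr.h)) (pt nL (σ * pr.h + ℓ')) ⊆ Finset.Icc B.B₀lo B.B₀hi) (hRlr : Rl ≤ r)
    -- the near-`c` block READ BY THE TWO LATTICE FUNCTIONALS (L-F2): bridge region, hop prism, zone box, fine extents
    {Λ₀ Λ₁ kpar kperp : ℤ}
    (hΛR : ∀ x ∈ Finset.Icc B.regionLo B.regionHi, |pr.vβ * (σ * x 0) - pr.vα * x 1| ≤ Λ₀ ∧ |(nL : ℤ) * x 1 - pr.h * (σ * x 0)| ≤ Λ₁)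
    (hΛQ0 : modulus nL pr.h pr.vα pr.vβ + (nL : ℤ) * ((3 * ℓ' : ℕ) : ℤ) ≤ Λ₀) (hΛQ1 : (nL : ℤ) * ((3 * ℓ' : ℕ) : ℤ) ≤ Λ₁) {Mz : ℕ}
    (hΛZ : (|pr.vβ| + |pr.vα|) * (Mz : ℤ) ≤ Λ₀ ∧ ((nL : ℤ) + |pr.h|) * (Mz : ℤ) ≤ Λ₁)
    (hnear₂ : ∀ c w, |pr.vβ * (φ w 0 - φ c 0) - pr.vα * (φ w 1 - φ c 1)| ≤ Λ₀ → |(nL : ℤ) * (φ w 1 - φ c 1) - pr.h * (φ w 0 - φ c 0)| ≤ Λ₁ →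
      |fineSkel φ c pr.A nL pr.h pr.vα pr.vβ pr.c₀ pr.c₁ (pr.D / 2) (pr.D / 2) pr.D w du.1| ≤ kpar ∧
        |fineSkel φ c pr.A nL pr.h pr.vα pr.vβ pr.c₀ pr.c₁ (pr.D / 2) (pr.D / 2) pr.D w (oth du.1)| ≤ kperp)
    {kb : ℕ} (hkbMz : (Mz : ℤ) ≤ kb) (hπ1 : Mq * ((B.core1Lo 0).natAbs + (B.core1Lo 1).natAbs) ≤ r) (hclr₁ : (kb : ℤ) < B.B₀lo 0 - B.R' - B.pr)
    {Δ' : ℕ} {δ δK η : ℝ} (hδ : 0 < δ) (hδ1 : δ ≤ 1) (nF : ℕ)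
    (hchain : ∀ (c : V) (Nr N₃ : ℕ), 0 + 1 + Nr + 1 + N₃ ≤ nF → ∀ (W : Sym2 V → unitInterval) (s : Fin (0 + 1 + Nr + 1 + N₃ + 1) → TStep (winGraph G c r))
      (T' : Fin (0 + 1 + Nr + 1 + N₃ + 1) → Finset V) (η : ℝ),
      (∀ i, (s i).L.o = (s 0).L.o) →
      (∀ i : Fin (0 + 1 + Nr + 1 + N₃), T' (Fin.castSucc i) ⊆ (s i.succ).L.X 0) →
      (∀ i, T' i ⊆ (s i).T) →
      (∀ i, (s i).KitsAtF W q Δ' δ) →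
      η ≤ δ / 2 →
      (∀ i, (prodBernoulli W).real (⋃ t ∈ (s i).T \ T' i, openConn (s 0).L.o t) ≤ η) →
      1 - δ < (prodBernoulli W).real (s 0).L.reachB →
        1 - δK ^ 3 < (prodBernoulli W).real (⋃ t ∈ T' (Fin.last (0 + 1 + Nr + 1 + N₃)), openConn (s 0).L.o t))
    (hcount₁ : 1 / (1 - (q : ℝ)) ^ (Δ' * N₁) ≤ δ * ((Finset.Icc j₀₁ j₁₁).card : ℝ))
    (hcount₂ : 1 / (1 - (q : ℝ)) ^ (Δ' * N₂) ≤ δ * ((Finset.Icc j₀₂ j₁₂).card : ℝ))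
    (hcount₃ : 1 / (1 - (q : ℝ)) ^ (Δ' * N₃') ≤ δ * ((Finset.Icc j₀₃ j₁₃).card : ℝ))
    (hη : η ≤ δ / 2)
    (Pb Pr : ApronPrm) {Rs KCmaxb KCmaxr rsb rsr cSb cSr cU r₁ r₂ Rb : ℕ}
    (hPNb : Mq ≤ Pb.N) (hAb : Pb.A = (Mz : ℤ) + 2)
    (hdDb : Pb.d + 2 ≤ shellD Pb) (hDρb : Rs + 1 ≤ shellD Pb) (hKCmaxb : shellD Pb + Mz + 1 ≤ KCmaxb)
    (hwideb : ∀ j, j₀₁ ≤ j → j ≤ j₁₁ → ∀ i, (B.B₀lo - (j : Site 2)) i + 2 * tanOff Pb.ℓs Pb.M ≤ (B.B₀hi + (j : Site 2)) i)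
    (hdwb : ∀ j, j₀₁ ≤ j → j ≤ j₁₁ → ∀ i, (B.B₀lo - (j : Site 2)) i + (Pb.d + 2 : ℕ) ≤ (B.B₀hi + (j : Site 2)) i)
    (hDwb : ∀ j, j₀₁ ≤ j → j ≤ j₁₁ → ∀ i, (B.B₀lo - (j : Site 2)) i + ((shellD Pb + 1 + Pb.d + Pb.N * KCmaxb + Rs : ℕ) : ℤ) ≤ (B.B₀hi + (j : Site 2)) i)
    (hT'b : (shellD Pb : ℤ) + Pb.N * KCmaxb + Rs ≤ tanOff Pb.ℓs Pb.M)
    (hr₀b : Pb.N * (tanOff Pb.ℓs Pb.M + 2) + Pb.N * Pb.d + (Pb.N * KCmaxb + Rs) ≤ Pb.r₀) (hRb₀ : Pb.r₀ ≤ r)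
    (hrsb : 1 + (Pb.N * (tanOff Pb.ℓs Pb.M + 2) + Pb.N * Pb.d + (Pb.N * KCmaxb + Rs)) ≤ rsb)
    (hcSb : (Pb.N + 1) * (tanOff Pb.ℓs Pb.M + 1) + (Pb.N + 1) * Pb.d + (KCmaxb + 1) * (Pb.N + 2) + cU ≤ cSb)
    (hEb : j₁₁ + (Pb.N * (tanOff Pb.ℓs Pb.M + 1) + Pb.N * Pb.d + Pb.N * KCmaxb) ≤ B.R')
    (hreachb : r₁ + (Pb.N * (tanOff Pb.ℓs Pb.M + 1) + Pb.N * Pb.d + Pb.N * KCmaxb) ≤ Pb.r₀) (hr₁ : Rb ≤ r₁) (hr₁R : r₁ ≤ r)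
    (hPNr : Mq * (kq + 3) ≤ Pr.N) (hAr : Pr.A = (Mz + 1 : ℕ) * (shearUnit nL pr.h : ℤ) + 1)
    (hdDr : Pr.d + 2 ≤ shellD Pr) (hDρr : Rs + 1 ≤ shellD Pr) (hKCmaxr : (shellD Pr + Mz + 1) * (kq + 1) ≤ KCmaxr)
    (hwider : ∀ Nr, ∀ k ≤ Nr, ∀ j, j₀₂ ≤ j → j ≤ j₁₂ → ∀ i, ((xRunSched nL ℓ' pr.h R's qB Nr).lo k - (j : Site 2)) i + 2 * tanOff Pr.ℓs Pr.M ≤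
      ((xRunSched nL ℓ' pr.h R's qB Nr).hi k + (j : Site 2)) i)
    (hdwr : ∀ Nr, ∀ k ≤ Nr, ∀ j, j₀₂ ≤ j → j ≤ j₁₂ → ∀ i, ((xRunSched nL ℓ' pr.h R's qB Nr).lo k - (j : Site 2)) i + (Pr.d + 2 : ℕ) ≤
      ((xRunSched nL ℓ' pr.h R's qB Nr).hi k + (j : Site 2)) i)
    (hDwr : ∀ Nr, ∀ k ≤ Nr, ∀ j, j₀₂ ≤ j → j ≤ j₁₂ → ∀ i, ((xRunSched nL ℓ' pr.h R's qB Nr).lo k - (j : Site 2)) i + ((shellD Pr + 1 + Pr.d + Pr.N * KCmaxr + Rs : ℕ) : ℤ) ≤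
      ((xRunSched nL ℓ' pr.h R's qB Nr).hi k + (j : Site 2)) i)
    (hwidey : ∀ N₃, ∀ k ≤ N₃, ∀ j, j₀₃ ≤ j → j ≤ j₁₃ → ∀ i, ((yRunSched hnL hvL hlay R'₃ qB₃ N₃).lo k - (j : Site 2)) i + 2 * tanOff Pr.ℓs Pr.M ≤
      ((yRunSched hnL hvL hlay R'₃ qB₃ N₃).hi k + (j : Site 2)) i)
    (hdwy : ∀ N₃, ∀ k ≤ N₃, ∀ j, j₀₃ ≤ j → j ≤ j₁₃ → ∀ i, ((yRunSched hnL hvL hlay R'₃ qB₃ N₃).lo k - (j : Site 2)) i + (Pr.d + 2 : ℕ) ≤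
      ((yRunSched hnL hvL hlay R'₃ qB₃ N₃).hi k + (j : Site 2)) i)
    (hDwy : ∀ N₃, ∀ k ≤ N₃, ∀ j, j₀₃ ≤ j → j ≤ j₁₃ → ∀ i, ((yRunSched hnL hvL hlay R'₃ qB₃ N₃).lo k - (j : Site 2)) i + ((shellD Pr + 1 + Pr.d + Pr.N * KCmaxr + Rs : ℕ) : ℤ) ≤
      ((yRunSched hnL hvL hlay R'₃ qB₃ N₃).hi k + (j : Site 2)) i)
    (hT'r : (shellD Pr : ℤ) + Pr.N * KCmaxr + Rs ≤ tanOff Pr.ℓs Pr.M)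
    (hr₀r : Pr.N * (tanOff Pr.ℓs Pr.M + 2) + Pr.N * Pr.d + (Pr.N * KCmaxr + Rs) ≤ Pr.r₀) (hRr₀ : Pr.r₀ ≤ r)
    (hrsr : 1 + (Pr.N * (tanOff Pr.ℓs Pr.M + 2) + Pr.N * Pr.d + (Pr.N * KCmaxr + Rs)) ≤ rsr)
    (hcSr : (Pr.N + 1) * (tanOff Pr.ℓs Pr.M + 1) + (Pr.N + 1) * Pr.d + (KCmaxr + 1) * (Pr.N + 2) + cU ≤ cSr)
    (hEr : j₁₂ + (Pr.N * (tanOff Pr.ℓs Pr.M + 1) + Pr.N * Pr.d + Pr.N * KCmaxr) ≤ R's)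
    (hEy : j₁₃ + (Pr.N * (tanOff Pr.ℓs Pr.M + 1) + Pr.N * Pr.d + Pr.N * KCmaxr) ≤ R'₃)
    (hreachr : r₂ + (Pr.N * (tanOff Pr.ℓs Pr.M + 1) + Pr.N * Pr.d + Pr.N * KCmaxr) ≤ Pr.r₀) (hr₂ : Rl ≤ r₂) (hr₂R : r₂ ≤ r)
    (Rg : V → Finset V) (hRg : ∀ c', ∀ u ∈ Rg c', u ∈ graphBall G c' Rs) (hRgcard : ∀ c', (Rg c').card ≤ cU) (hcU1 : 1 ≤ cU)
    (Λc : V → ℕ → Finset V) (kz : ℕ) (hΛ : ∀ c', ∀ v ∈ Λc c' kz, v ∈ Rg c' ∧ φ v - φ c' ∈ box 2 Mz) (hclrz : (Mz + 4) * (nL + pr.h.natAbs) ≤ nL * (ℓ' + 1))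
    (hcz : ∀ c, c ∈ Λc c kz) (hzconn : ∀ c, ∀ s ∈ Λc c kz, PathIn G (↑(Λc c kz) : Set V) c s) (hRsr : Rs ≤ r)


    {ρZ : ℕ} (hZρ : ∀ c', ∀ s ∈ Λc c' kz, s ∈ graphBall G c' ρZ) (hρr : ρZ ≤ r)
    (hZU : ∀ c, Λc c kz ⊆ pgramPrismFin G φ c nL pr.h (3 * ℓ') Rl)
    (Qb Fb : V → Finset V)
    (hQb : ∀ c c', ∀ w ∈ Qb c', w ∈ graphBall G c' Rb ∧
      rootFrame φ c σ w ∈ Finset.Icc (rootFrame φ c σ c' - ((B.pr : ℕ) : Site 2)) (rootFrame φ c σ c' + ((B.pr : ℕ) : Site 2)))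
    (hFb : ∀ c c', ∀ w ∈ Fb c', w ∈ Qb c' ∧ rootFrame φ c σ w ∈ Finset.Icc (rootFrame φ c σ c' + B.dlo) (rootFrame φ c σ c' + B.dhi))
    (kk₁ kk₂ kk₃ : ℕ) (hkN₁ : kk₁ * (Δg + 1) ^ (2 * rsb) ≤ N₁) (hkN₂ : kk₂ * (Δg + 1) ^ (2 * rsr) ≤ N₂) (hkN₃ : kk₃ * (Δg + 1) ^ (2 * rsr) ≤ N₃')
    (hk₁ : (1 - (q : ℝ) ^ (1 + Δg * cSb + cSb * cU)) ^ kk₁ ≤ δ) (hk₂ : (1 - (q : ℝ) ^ (1 + Δg * cSr + cSr * cU)) ^ kk₂ ≤ δ)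
    (hk₃ : (1 - (q : ℝ) ^ (1 + Δg * cSr + cSr * cU)) ^ kk₃ ≤ δ)
    (hbridge : ∀ c', 1 - δ ^ 3 < (bondPercolation G q).real (linkIn (↑(Qb c') : Set V) (Λc c' kz) (Fb c')))
    (hlongx : ∀ c' (τ : ℤ), τ = 1 ∨ τ = -1 → 1 - δ ^ 3 < (bondPercolation G q).real
      (linkIn (pgramPrism G φ c' nL pr.h (3 * ℓ') Rl) (Λc c' kz) (pgSideHalfW G φ c' nL pr.h ℓ' Rl σ (σ * τ))))
    (hlongy : ∀ c' (τ : ℤ), τ = 1 ∨ τ = -1 → 1 - δ ^ 3 < (bondPercolation G q).real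
      (linkIn (pgramPrism G φ c' nL pr.h (3 * ℓ') Rl) (Λc c' kz) (pgTopPieceW G φ c' nL pr.h ℓ' Rl 1 τ pr.vα)))
    {m : ℕ} (hDm : ∀ d ∈ stepRg G (pr.frame φ w₀ du.1 b) (faceStepWNbV G pr φ P w₀ Λ b₀ b a' x du j pc aw Rlev N M L' Sfin),
      ∀ d' ∈ stepRg G (pr.frame φ w₀ du.1 b) (faceStepWNbV G pr φ P w₀ Λ b₀ b a' x du j pc aw Rlev N M L' Sfin), φ d - φ d' ∈ box 2 m)
    {R₁ : ℕ}
    (hR₁ : ∀ (c' : V) (R' : ℕ), R₁ ≤ R' → ∀ (Rw : ℕ) (D' B' : Finset V), (∀ d ∈ D', d ∈ graphBall G c' Rw) →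
      (∀ d ∈ D', ∀ d' ∈ D', φ d - φ d' ∈ box 2 m) → B' ⊆ D' → (∀ a ∈ B', a ∈ graphBall G c' ρZ) →
        (bondPercolation G q).real (excess G c' R' D' B') ≤ η)
    (hR₁b : R₁ ≤ r - Pb.r₀) (hR₁r : R₁ ≤ r - Pr.r₀)
    -- THE PER-CENTRE NUMBERS
    (nums : ∀ c, pr.frame φ w₀ du.1 b c ∈ Finset.Icc (loNV P x du j pc aw - ((E : ℕ) : Site 2)) (hiNV P x du j pc aw + ((E : ℕ) : Site 2)) →
      c ∈ graphBall G w₀ (Λ.rE a' x du - r) →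
      FaceRunNumsX4 G φ (pr.ψ φ w₀) c pr.A nL pr.h pr.vα pr.vβ pr.c₀ pr.c₁ pr.D du σ B ℓ' R's qB R'₃ qB₃ pr.vα hnL hvL hlay Mz
        (P.farCore x du j k₀) (targetMMV G φ pr P w₀ Λ b₀ a' x du L') (Λc c Mz) r kpar kperp)
    -- the inner-chain LENGTH BUDGET `nF` covers every centre's chain (p3-g11 2026-08-22T02:23:54Z: a chain fact at a fixed kit accuracy holds up to a budget)
    (hnF : ∀ c h1 h2, 0 + 1 + (nums c h1 h2).Nr + 1 + (nums c h1 h2).N₃ ≤ nF)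
    -- ONE-SIDED ((R-44)(c)): the numbers' tangential sign is the served sign `1`
    (hσT1 : ∀ c h1 h2, (nums c h1 h2).σT = 1)
    -- (WAVE-Q, located design item L-stmt-1, option (C); refuter read p5-g28 2026-08-27T09:25:46Z) THE RUN-LENGTH FLOORS AT QUASI-STEP COST `Mq`, beside the numbers
    -- (the structure's `Mq`-free fields `hπ2/hπ3` are NOT read; these are lower bounds on the face radius `r` over the numbers' `RcL/RcT/Nr/N₃`)
    (hπ2M : ∀ c h1 h2, (nums c h1 h2).RcL + Mq * (((nums c h1 h2).Nr + 1) * shearUnit nL pr.h) ≤ r)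
    (hπ3M : ∀ c h1 h2, ∀ k ≤ (nums c h1 h2).N₃, (nums c h1 h2).RcT + Mq * (((((k + 1 : ℕ) : ℤ) * pr.vα).natAbs +
      (((shearUnit nL pr.h : ℤ) * |((k + 1 : ℕ) : ℤ) * (yPrmW nL ℓ' pr.h pr.vα R'₃ qB₃ (nums c h1 h2).N₃).sLo| + |pr.h| * |((k + 1 : ℕ) : ℤ) * pr.vα| +
        shearUnit nL pr.h) / nL).natAbs + 1)) ≤ r) :
    ∀ c, pr.frame φ w₀ du.1 b c ∈ Finset.Icc (loNV P x du j pc aw - ((E : ℕ) : Site 2)) (hiNV P x du j pc aw + ((E : ℕ) : Site 2)) →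
      c ∈ graphBall G w₀ (Λ.rE a' x du - r) →
      ∃ Qt Ft : Finset V, Ft ⊆ (faceStepWNbV G pr φ P w₀ Λ b₀ b a' x du j pc aw Rlev N M L' Sfin).T ∧
        Qt ⊆ stepRg G (pr.frame φ w₀ du.1 b) (faceStepWNbV G pr φ P w₀ Λ b₀ b a' x du j pc aw Rlev N M L' Sfin) ∧
        1 - δK ^ 3 ≤ (prodBernoulli Wt).real (linkIn (↑Qt : Set V) (Λc c kz) Ft) := by
  intro c hc1 hc2
  set Q := faceStepWNbV G pr φ P w₀ Λ b₀ b a' x du j pc aw Rlev N M L' Sfin with hQ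
  have hnF' := hnF c hc1 hc2
  set 𝓝 := nums c hc1 hc2 with h𝓝
  have hσ𝓝 : 𝓝.σT = 1 := hσT1 c hc1 hc2
  have hLI : pr.cOf du.1 * pr.L du.1 ≤ pr.D := pr.cOf_mul_L_le hL0 hL1 du.1
  have hlipF : Lip G (pr.frame φ w₀ du.1 b) := pr.lip_frame hlipφ w₀ du.1 b (pr.cOf_pos hc₀ hc₁ du.1).le hD hLI
  -- the habitat lies in the region, the target in `T`, the region in the outer ball
  have hPlD : Win G (pr.ψ φ w₀) w₀ (P.farCore x du j k₀) (Λ.rE a' x du) ⊆ stepRg G (pr.frame φ w₀ du.1 b) Q :=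
    Win_subset_stepRgNbV G φ P w₀ Λ b₀ a' pc aw Rlev N M L' Sfin hlipF hc₀ hc₁ hD hnz hk₀ P.farCore_spec le_rfl
  have hMT : targetMMV G φ pr P w₀ Λ b₀ a' x du L' ⊆ Q.T :=
    targetMM_subset_TV (Win_subset_stepRgNbV G φ P w₀ Λ b₀ a' pc aw Rlev N M L' Sfin hlipF hc₀ hc₁ hD hnz hk₀ (P.Mb_thick_mem_farASS₂ hjK hbpar hbperp)
      le_rfl)
  have hDπ : ∀ u ∈ stepRg G (pr.frame φ w₀ du.1 b) Q, u ∈ graphBall G w₀ (Λ.rE a' x du) := fun u hu =>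
    ((mem_Win G _).1 (stepRgNb_subset_WinV G pr φ P w₀ Λ b₀ b a' x du j pc aw Rlev N M L' Sfin hu)).1
  -- the near-`c` footprint reading (Λ-form)
  have hnear : ∀ w, |pr.vβ * (φ w 0 - φ c 0) - pr.vα * (φ w 1 - φ c 1)| ≤ Λ₀ → |(nL : ℤ) * (φ w 1 - φ c 1) - pr.h * (φ w 0 - φ c 0)| ≤ Λ₁ →
      FootBox 𝓝.flo 𝓝.fhi 𝓝.fw du (fineSkel φ c pr.A nL pr.h pr.vα pr.vβ pr.c₀ pr.c₁ (pr.D / 2) (pr.D / 2) pr.D w) := fun w h0 h1 =>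
    footBox_of_abs_le (hnear₂ c w h0 h1).1 (hnear₂ c w h0 h1).2 𝓝.hfR.1 𝓝.hfR.2.1 𝓝.hfR.2.2
  -- the zone seed: inside the short region, the long prism, the face-step region
  have hZball : ∀ s ∈ Λc c kz, s ∈ graphBall G c Rs := fun s hs => hRg c s (hΛ c s hs).1
  have hZb : ∀ s ∈ Λc c kz, φ s - φ c ∈ box 2 Mz := fun s hs => (hΛ c s hs).2
  have hZbox : ∀ s ∈ Λc c kz, |φ s 0 - φ c 0| ≤ Mz ∧ |φ s 1 - φ c 1| ≤ Mz := fun s hs => by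
    have hb := hZb s hs
    rw [mem_box] at hb
    have h0 := hb 0; have h1 := hb 1
    simp only [Pi.sub_apply] at h0 h1
    exact ⟨abs_le.2 ⟨h0.1, h0.2⟩, abs_le.2 ⟨h1.1, h1.2⟩⟩
  have hSφ : ∀ s ∈ Λc c kz, |φ s 0 - φ c 0| ≤ kb := fun s hs => (hZbox s hs).1.trans hkbMz
  -- the zone box read by the two functionals
  have hZΛ : ∀ s ∈ Λc c kz, |pr.vβ * (φ s 0 - φ c 0) - pr.vα * (φ s 1 - φ c 1)| ≤ Λ₀ ∧
      |(nL : ℤ) * (φ s 1 - φ c 1) - pr.h * (φ s 0 - φ c 0)| ≤ Λ₁ := fun s hs => by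
    obtain ⟨h0, h1⟩ := hZbox s hs
    have hM : (0 : ℤ) ≤ Mz := by positivity
    constructor
    · refine le_trans ?_ hΛZ.1
      calc |pr.vβ * (φ s 0 - φ c 0) - pr.vα * (φ s 1 - φ c 1)|
          ≤ |pr.vβ * (φ s 0 - φ c 0)| + |pr.vα * (φ s 1 - φ c 1)| := abs_sub _ _
        _ ≤ |pr.vβ| * Mz + |pr.vα| * Mz := by
            rw [abs_mul, abs_mul]
            exact add_le_add (mul_le_mul_of_nonneg_left h0 (abs_nonneg _)) (mul_le_mul_of_nonneg_left h1 (abs_nonneg _))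
        _ = (|pr.vβ| + |pr.vα|) * (Mz : ℤ) := by ring
    · refine le_trans ?_ hΛZ.2
      calc |(nL : ℤ) * (φ s 1 - φ c 1) - pr.h * (φ s 0 - φ c 0)|
          ≤ |(nL : ℤ) * (φ s 1 - φ c 1)| + |pr.h * (φ s 0 - φ c 0)| := abs_sub _ _
        _ ≤ (nL : ℤ) * Mz + |pr.h| * Mz := by
            rw [abs_mul, abs_mul, Nat.abs_cast]
            exact add_le_add (mul_le_mul_of_nonneg_left h1 (by positivity)) (mul_le_mul_of_nonneg_left h0 (abs_nonneg _))
        _ = ((nL : ℤ) + |pr.h|) * (Mz : ℤ) := by ring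
  -- the two bands' seed clearances, read off the served fields at the zone seed
  have hclear₂ : ∀ k ≤ 𝓝.Nr, ∀ w ∈ graphBall G c r, runX φ 𝓝.cL nL pr.h σ w ∈ (xRunSched nL ℓ' pr.h R's qB 𝓝.Nr).region k → w ∉ Λc c kz :=
    fun k hk w _ hw => 𝓝.hclrA (Λc c kz) hZb k hk w hw
  have hclear₃ : ∀ k ≤ 𝓝.N₃, ∀ w ∈ graphBall G c r,
      runY φ 𝓝.cT nL pr.h 𝓝.σT w ∈ (yRunSched hnL hvL hlay R'₃ qB₃ 𝓝.N₃).region k → w ∉ Λc c kz :=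
    fun k hk w _ hw => 𝓝.hclrT (Λc c kz) hZb k hk w hw
  have hball : ∀ {w : V}, w ∈ graphBall G c r → w ∈ graphBall G w₀ (Λ.rE a' x du) := by
    intro w hw
    have h2 := BoxProdZ2.mem_graphBall_add G hc2 hw
    rwa [Nat.sub_add_cancel hrE] at h2
  have hSD : Λc c kz ⊆ stepRg G (pr.frame φ w₀ du.1 b) Q := fun s hs => by
    obtain ⟨h0, h1⟩ := hZbox s hs
    have hsr : s ∈ graphBall G c r := graphBall_mono G c hRsr (hZball s hs)
    exact hPlD ((mem_Win G _).2 ⟨hball hsr, 𝓝.hPlfoot s hsr (hnear s (hZΛ s hs).1 (hZΛ s hs).2)⟩)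
  -- the hop: the served long side half at `c`, seeded by the zone seed
  have hσsq : σ * σ = 1 := by rcases hσ with rfl | rfl <;> norm_num
  have hlink : 1 - δ < (bondPercolation G q).real
      (linkIn (↑(pgramPrismFin G φ c nL pr.h (3 * ℓ') Rl) : Set V) (Λc c kz) (pgSideHalfW G φ c nL pr.h ℓ' Rl σ 1)) := by
    have hcoe : (↑(pgramPrismFin G φ c nL pr.h (3 * ℓ') Rl) : Set V) = pgramPrism G φ c nL pr.h (3 * ℓ') Rl := by ext w; simp
    have h1 := hlongx c σ hσ
    rw [hσsq] at h1
    rw [hcoe]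
    have hδ2 : δ ^ 3 ≤ δ := pow_le_of_le_one hδ.le hδ1 (by norm_num)
    linarith
  obtain ⟨Qt, Ft, hFT, hQD, -, hlt⟩ := faceRoute_of_numbers7_xFCQ hlipφ hqφ hΔg hWG hWD hDπ hc2 hrE hPlD hMT 𝓝.hMZ du hσ hA0.le hnL pr.h hmf
    hc₀.le hc₁.le hD 𝓝.hPlfoot 𝓝.hMfoot (hcz c) (hzconn c) hSD (hZρ c) hρr hSφ B hB hκL ℓ' R's qB 𝓝.Nr Rl 𝓝.hσT hvL hlay R'₃ qB₃ 𝓝.N₃ 𝓝.cL 𝓝.cT 𝓝.hcLφ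
    𝓝.hcTφ 𝓝.hcLπ 𝓝.hcTπ Rlev₁ N₁ j₀₁ j₁₁ Rlev₂ N₂ j₀₂ j₁₂ Rlev₃ N₃' j₀₃ j₁₃ hRl₁ hRl₂ hRl₃ hj₁ hj₂ hj₃ hB0 hRlr hΛR hvL hΛQ0 hΛQ1 hnear 𝓝.hreg 𝓝.hP0
    𝓝.hP1 𝓝.hP2 𝓝.hP3 𝓝.hPf₁ 𝓝.hPf₂ 𝓝.hPf₃ 𝓝.hregY 𝓝.hlastc 𝓝.hY0 𝓝.hY1 𝓝.hY2 𝓝.hY3 𝓝.hYf₁ 𝓝.hYf₂ 𝓝.hYf₃ 𝓝.hL0 𝓝.hL1 𝓝.hL2 𝓝.hL3 𝓝.hxa 𝓝.hxb 𝓝.hxy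
    hclr₁ hclear₂ hclear₃ hπ1 (hπ2M c hc1 hc2) (hπ3M c hc1 hc2) subset_rfl (hZU c) hδ hlink (hchain c 𝓝.Nr 𝓝.N₃ hnF') hcount₁ hcount₂ hcount₃ hη Pb Pr hPNb hAb hdDb hDρb
    hKCmaxb hwideb hdwb hDwb hT'b hr₀b hRb₀ hrsb hcSb hEb hreachb hr₁ hr₁R hPNr hAr hdDr hDρr hKCmaxr (hwider 𝓝.Nr) (hdwr 𝓝.Nr) (hDwr 𝓝.Nr) (hwidey
    𝓝.N₃) (hdwy 𝓝.N₃) (hDwy 𝓝.N₃) hT'r hr₀r hRr₀ hrsr hcSr hEr hEy hreachr hr₂ hr₂R Rg hRg hRgcard hcU1 Λc kz (fun c' v hv => (hΛ c' v hv).1) hzconn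
    hcz hclrz Qb Fb (hQb c) (hFb c) kk₁ kk₂ kk₃ hkN₁ hkN₂ hkN₃ hk₁ hk₂ hk₃ hbridge hlongx
    (fun c' τ hτ => by rw [hσ𝓝]; exact hlongy c' τ hτ) hDm hR₁ hR₁b hR₁r
  exact ⟨Qt, Ft, hFT, hQD, hlt.le⟩

end Skelφ

end Summit.CriticalPhenomena.PercolationContinuityZ3.Theorems.Transplant

end
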